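import Literature.MathematicalPhysics.QuantumManyBody.LiebYngvasonPoincare
import Literature.MathematicalPhysics.QuantumManyBody.PeriodicBoseGas
import Mathlib.MeasureTheory.Group.Measure
import Mathlib.MeasureTheory.Measure.Haar.InnerProductSpace
import HarnessLib

/-!
# Neumann–Poincaré on translated cubes and the cube tiling of the torus cell (helper file)

Route `BECStronglyRayleigh`, crux `LatticeToPeriodicBridge` (stmt-AtomisticToContinuum-9674),
line `coarse-cell-lorentzian`, stub `stub_cellNormRetention` (S2, cell norm retention): first of
three files (`…CellPoincare`, `…CellPairSplit`, `…CellNormRetention`); generic real-variable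
input, independent of the line's `Defs` module.

* `isPoincare_map_add_right`: the Poincaré property `IsPoincare` of `LiebYngvasonPoincare.lean`
  (`∫ ‖f − ⨍f‖² dμ ≤ K ∫ ∑ᵢ ‖∂_{dirᵢ} f‖² dμ` on bounded `C¹` maps) is invariant under
  translating the measure; hence Lebesgue measure on ANY half-open cube
  `cubeIco c b = ∏ₖ [cₖ, cₖ + b) ⊂ ℝ³` has it for the coordinate directions with the Neumann
  constant `(b/π)²` of `isPoincare_space` (`isPoincare_cubeIco`; the translate of the open box
  `(0,b)³` and the half-open cube differ by a null set, `preimage_Ioo_ae_eq_cubeIco`).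
* `sq_integral_le_of_contDiff`: the variance form on a PAIR of cubes `C × C' ⊂ ℝ³ × ℝ³` for
  every `C¹` function `F` (cut off outside a ball by `exists_bddC1_eq_of_contDiff`):
  `∫_{C×C'} F² ≤ (∫_{C×C'} F)²/b⁶ + (b/π)² ∫_{C×C'} (|∇_ξ F|² + |∇_η F|²)`.
* The `M³` cubes of side `L/M` with corners `corner M (L/M) x = (L/M)·x`, `x ∈ (Fin M)³`, tile
  `cell L = [0,L)³` (`iUnion_cubeIco_corner`, `pairwise_disjoint_cubeIco_corner`; the splitting
  of integrals over `cell L × cell L` into the `M⁶` cube pairs is in `…CellNormRetention`).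

Everything is declared in the sub-namespace `….CoarseCellLorentzian.CellNormRetention` of the
skeleton's namespace (no clash with the `Defs` module or the sibling stub files).
`measurePreserving_add_right`, `Measure.pi_Ico_ae_eq_pi_Icc`, `PiLp.volume_preserving_ofLp`
are Mathlib's. References: Payne–Weinberger 1960 (optimal Poincaré
constant for convex domains; for cubes the tensorised interval bound suffices); LSSY2005, after
(2.50) (the Neumann gap `π²/ℓ²` of a cube).
-/

noncomputable section

open MeasureTheory Filter Metric Set
open scoped ENNReal Topology NNReal Real

namespace Summit.AtomisticToContinuum.BoseEinsteinCondensation.Cruxes.LatticeToPeriodicBridge.CoarseCellLorentzian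

namespace CellNormRetention

open Literature.MathematicalPhysics.QuantumManyBody.BoseGas
open Literature.MathematicalPhysics.QuantumManyBody.BoseGas.Poincare

/-! ## Translating the Poincaré property -/

section Translate

variable {E : Type*} [NormedAddCommGroup E] [InnerProductSpace ℝ E]
  {X : Type*} [NormedAddCommGroup X] [NormedSpace ℝ X] [MeasurableSpace X] [BorelSpace X]
  {μ : Measure X} {ι : Type*} [Fintype ι] {K : ℝ}

/-- **Translation invariance of the Poincaré property**: if `μ` has the Poincaré property for the
directions `dir` with constant `K`, so does its push-forward under the translation `x ↦ x + c`
(same directions, same constant): test `f` on the translate by testing `f(· + c)` on `μ`.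
[folklore] -/
theorem isPoincare_map_add_right {dir : ι → X} (h : IsPoincare E X μ dir K) (c : X) :
    IsPoincare E X (μ.map (· + c)) dir K := by
  intro f hf
  obtain ⟨hf1, ⟨C, hC⟩, ⟨C', hC'⟩⟩ := hf
  set g : X → E := fun x => f (x + c) with hg_def
  have hgd : ∀ x, fderiv ℝ g x = fderiv ℝ f (x + c) := fun x => fderiv_comp_add_right c
  have hg : BddC1 g :=
    ⟨hf1.comp (contDiff_id.add contDiff_const), ⟨C, fun x => hC _⟩,
      ⟨C', fun x => by rw [hgd]; exact hC' _⟩⟩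
  have key := h g hg
  have hemb : MeasurableEmbedding fun x : X => x + c := measurableEmbedding_addRight c
  have hint : ∀ φ : X → ℝ, ∫ y, φ y ∂(μ.map (· + c)) = ∫ x, φ (x + c) ∂μ :=
    fun φ => hemb.integral_map φ
  have hintE : ∀ φ : X → E, ∫ y, φ y ∂(μ.map (· + c)) = ∫ x, φ (x + c) ∂μ :=
    fun φ => hemb.integral_map φ
  have huniv : (μ.map (· + c)).real univ = μ.real univ := by
    rw [measureReal_def, measureReal_def, hemb.map_apply, preimage_univ]
  have havg : ⨍ y, f y ∂(μ.map (· + c)) = ⨍ x, g x ∂μ := by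
    rw [average_eq, average_eq, hintE, huniv]
  rw [hint, hint, havg]
  simpa only [hgd] using key

end Translate

/-! ## Cubes of side `b` in `ℝ³` -/

section Cubes

/-- The half-open cube `∏ₖ [cₖ, cₖ + b)` with lower corner `c`. [folklore] -/
def cubeIco (c : Fin 3 → ℝ) (b : ℝ) : Set Space :=
  {ξ | ∀ k, ξ k ∈ Ico (c k) (c k + b)}

/-- The closed cube `∏ₖ [cₖ, cₖ + b]`. [folklore] -/
def cubeIcc (c : Fin 3 → ℝ) (b : ℝ) : Set Space :=
  {ξ | ∀ k, ξ k ∈ Icc (c k) (c k + b)}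

/-- The half-open cube as a preimage under `ofLp : ℝ³ → (Fin 3 → ℝ)`. [folklore] -/
theorem cubeIco_eq_preimage (c : Fin 3 → ℝ) (b : ℝ) :
    cubeIco c b =
      (@WithLp.ofLp 2 (Fin 3 → ℝ)) ⁻¹' (univ.pi fun k => Ico (c k) (c k + b)) := by
  ext ξ; simp [cubeIco]

/-- The closed cube as a preimage under `ofLp`. [folklore] -/
theorem cubeIcc_eq_preimage (c : Fin 3 → ℝ) (b : ℝ) :
    cubeIcc c b =
      (@WithLp.ofLp 2 (Fin 3 → ℝ)) ⁻¹' (univ.pi fun k => Icc (c k) (c k + b)) := by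
  ext ξ; simp [cubeIcc, Pi.le_def, forall_and]

/-- The open box `(0,b)³` is the translate by `-c` of the open cube with corner `c`. [folklore] -/
theorem box_add_eq_preimage (c : Fin 3 → ℝ) (b : ℝ) :
    (fun ξ : Space => ξ + WithLp.toLp 2 c) ⁻¹'
        ((@WithLp.ofLp 2 (Fin 3 → ℝ)) ⁻¹' (univ.pi fun k => Ioo (c k) (c k + b))) =
      box b := by
  ext ξ
  simp only [box, mem_preimage, mem_univ_pi, mem_Ioo, mem_setOf_eq, WithLp.ofLp_add,
    Pi.add_apply]
  refine forall_congr' fun k => ?_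
  constructor <;> rintro ⟨h1, h2⟩ <;> constructor <;> linarith

/-- The half-open cube is measurable. [folklore] -/
theorem measurableSet_cubeIco (c : Fin 3 → ℝ) (b : ℝ) : MeasurableSet (cubeIco c b) := by
  rw [cubeIco_eq_preimage]
  exact (MeasurableSet.univ_pi fun _ => measurableSet_Ico).preimage
    (PiLp.continuous_ofLp 2 _).measurable

/-- The closed cube is compact. [folklore] -/
theorem isCompact_cubeIcc (c : Fin 3 → ℝ) (b : ℝ) : IsCompact (cubeIcc c b) := by
  have h : cubeIcc c b =
      (@WithLp.toLp 2 (Fin 3 → ℝ)) '' (univ.pi fun k => Icc (c k) (c k + b)) := by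
    rw [cubeIcc_eq_preimage]
    ext ξ
    simp only [mem_preimage, mem_image]
    constructor
    · intro h; exact ⟨WithLp.ofLp ξ, h, by simp⟩
    · rintro ⟨f, hf, rfl⟩; simpa using hf
  rw [h]
  exact (isCompact_univ_pi fun _ => isCompact_Icc).image (PiLp.continuous_toLp 2 _)

/-- `|∏ₖ [cₖ, cₖ + b)| = b³`. [folklore] -/
theorem volume_cubeIco (c : Fin 3 → ℝ) (b : ℝ) :
    volume (cubeIco c b) = ENNReal.ofReal b ^ 3 := by
  rw [cubeIco_eq_preimage, (PiLp.volume_preserving_ofLp (Fin 3)).measure_preimage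
    (MeasurableSet.univ_pi fun _ => measurableSet_Ico).nullMeasurableSet, volume_pi_pi]
  simp

/-- The half-open and the closed cube agree up to a null set. [folklore] -/
theorem cubeIco_ae_eq_cubeIcc (c : Fin 3 → ℝ) (b : ℝ) :
    cubeIco c b =ᵐ[volume] cubeIcc c b := by
  rw [cubeIco_eq_preimage, cubeIcc_eq_preimage]
  refine (PiLp.volume_preserving_ofLp (Fin 3)).quasiMeasurePreserving.preimage_ae_eq ?_
  rw [volume_pi]
  exact Measure.pi_Ico_ae_eq_pi_Icc

/-- The open cube and the half-open cube with the same corner agree up to a null set.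
[folklore] -/
theorem preimage_Ioo_ae_eq_cubeIco (c : Fin 3 → ℝ) (b : ℝ) :
    (@WithLp.ofLp 2 (Fin 3 → ℝ)) ⁻¹' (univ.pi fun k => Ioo (c k) (c k + b)) =ᵐ[volume]
      cubeIco c b := by
  rw [cubeIco_eq_preimage]
  refine (PiLp.volume_preserving_ofLp (Fin 3)).quasiMeasurePreserving.preimage_ae_eq ?_
  rw [volume_pi]
  exact Measure.pi_Ioo_ae_eq_pi_Icc.trans Measure.pi_Ico_ae_eq_pi_Icc.symm

/-- **Lebesgue measure on the cube `∏ₖ [cₖ, cₖ + b)` is the translate by `c` of Lebesgue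
measure on the box `(0,b)³`** (translation invariance, and the boundary is null). [folklore] -/
theorem map_add_restrict_box (c : Fin 3 → ℝ) (b : ℝ) :
    (volume.restrict (box b)).map (fun ξ : Space => ξ + WithLp.toLp 2 c) =
      volume.restrict (cubeIco c b) := by
  have hmp : MeasurePreserving (fun ξ : Space => ξ + WithLp.toLp 2 c) volume volume :=
    measurePreserving_add_right volume _
  have hemb : MeasurableEmbedding fun ξ : Space => ξ + WithLp.toLp 2 c :=
    measurableEmbedding_addRight _
  have h := (hmp.restrict_preimage_emb hemb
    ((@WithLp.ofLp 2 (Fin 3 → ℝ)) ⁻¹' (univ.pi fun k => Ioo (c k) (c k + b)))).map_eq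
  rw [box_add_eq_preimage] at h
  rw [h]
  exact Measure.restrict_congr_set (preimage_Ioo_ae_eq_cubeIco c b)

/-- Lebesgue measure restricted to a cube is finite (a theorem, not a global instance; used
through `haveI`). [folklore] -/
theorem isFiniteMeasure_restrict_cubeIco (c : Fin 3 → ℝ) (b : ℝ) :
    IsFiniteMeasure ((volume : Measure Space).restrict (cubeIco c b)) := by
  refine isFiniteMeasure_restrict.2 (ne_of_lt ?_)
  calc volume (cubeIco c b) ≤ volume (cubeIcc c b) :=
        measure_mono fun ξ hξ k => Ico_subset_Icc_self (hξ k)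
    _ < ⊤ := (isCompact_cubeIcc c b).measure_lt_top

variable {E : Type*} [NormedAddCommGroup E] [InnerProductSpace ℝ E] [CompleteSpace E]

/-- **The Neumann gap of a translated cube**: Lebesgue measure on `∏ₖ [cₖ, cₖ + b)` has the
Poincaré property for the coordinate directions with constant `(b/π)²`. [folklore] -/
theorem isPoincare_cubeIco (c : Fin 3 → ℝ) {b : ℝ} (hb : 0 < b) :
    IsPoincare E Space (volume.restrict (cubeIco c b))
      (fun k : Fin 3 => EuclideanSpace.single k (1 : ℝ)) ((b / π) ^ 2) := by
  rw [← map_add_restrict_box]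
  exact isPoincare_map_add_right (isPoincare_space hb) _

/-! ## Poincaré–Wirtinger on a pair of cubes, for `C¹` functions -/

/-- `∏[cₖ, cₖ+b) ⊆ ∏[cₖ, cₖ+b]`. [folklore] -/
theorem cubeIco_subset_cubeIcc (c : Fin 3 → ℝ) (b : ℝ) : cubeIco c b ⊆ cubeIcc c b :=
  fun _ hξ k => Ico_subset_Icc_self (hξ k)

/-- The product of two half-open cubes lies in the (compact) product of the closed ones.
[folklore] -/
theorem prod_cubeIco_subset (c c' : Fin 3 → ℝ) (b : ℝ) :
    cubeIco c b ×ˢ cubeIco c' b ⊆ cubeIcc c b ×ˢ cubeIcc c' b :=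
  Set.prod_mono (cubeIco_subset_cubeIcc c b) (cubeIco_subset_cubeIcc c' b)

/-- The product of two cubes lies in some open ball. [folklore] -/
theorem exists_prod_cubeIco_subset_ball (c c' : Fin 3 → ℝ) (b : ℝ) :
    ∃ R : ℝ, 0 < R ∧ cubeIco c b ×ˢ cubeIco c' b ⊆ ball (0 : Space × Space) R := by
  obtain ⟨R, hR, hsub⟩ :=
    ((isCompact_cubeIcc c b).prod (isCompact_cubeIcc c' b)).isBounded.subset_ball_lt 0 0
  exact ⟨R, hR, (prod_cubeIco_subset c c' b).trans hsub⟩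

/-- A continuous function is integrable on a product of two cubes. [folklore] -/
theorem integrableOn_prod_cubeIco {F : Type*} [NormedAddCommGroup F] {f : Space × Space → F}
    (hf : Continuous f) (c c' : Fin 3 → ℝ) (b : ℝ) :
    IntegrableOn f (cubeIco c b ×ˢ cubeIco c' b) volume :=
  (hf.continuousOn.integrableOn_compact
    ((isCompact_cubeIcc c b).prod (isCompact_cubeIcc c' b))).mono_set (prod_cubeIco_subset c c' b)

/-- `|C × C'| = b⁶` for two cubes of side `b ≥ 0`. [folklore] -/
theorem volume_real_prod_cubeIco (c c' : Fin 3 → ℝ) {b : ℝ} (hb : 0 ≤ b) :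
    (volume : Measure (Space × Space)).real (cubeIco c b ×ˢ cubeIco c' b) = b ^ 6 := by
  rw [measureReal_def, Measure.volume_eq_prod, Measure.prod_prod, volume_cubeIco,
    volume_cubeIco, ← pow_add, ← ENNReal.ofReal_pow hb, ENNReal.toReal_ofReal (by positivity)]

/-- **Poincaré–Wirtinger on a pair of cubes** (variance form): for `F ∈ C¹(ℝ³ × ℝ³; ℝ)` and two
cubes `C, C'` of side `b > 0`,
`∫_{C×C'} F² ≤ (∫_{C×C'} F)² / b⁶ + (b/π)² ∫_{C×C'} (|∇_ξ F|² + |∇_η F|²)` — the mean square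
minus the squared mean is the variance, which the Neumann gap `π²/b²` of the six-dimensional cube
(tensorisation `IsPoincare.prod` of two translated cubes) controls by the Dirichlet integral.
[folklore] -/
theorem sq_integral_le_of_contDiff {F : Space × Space → ℝ} (hF : ContDiff ℝ 1 F)
    (c c' : Fin 3 → ℝ) {b : ℝ} (hb : 0 < b) :
    ∫ p in cubeIco c b ×ˢ cubeIco c' b, F p ^ 2 ≤
      (∫ p in cubeIco c b ×ˢ cubeIco c' b, F p) ^ 2 / b ^ 6 +
        (b / π) ^ 2 * ∫ p in cubeIco c b ×ˢ cubeIco c' b,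
          ((∑ k, fderiv ℝ F p (EuclideanSpace.single k 1, 0) ^ 2) +
            ∑ k, fderiv ℝ F p (0, EuclideanSpace.single k 1) ^ 2) := by
  set Q := cubeIco c b ×ˢ cubeIco c' b with hQ
  have hQm : MeasurableSet Q := (measurableSet_cubeIco c b).prod (measurableSet_cubeIco c' b)
  have hμ : ((volume : Measure Space).restrict (cubeIco c b)).prod
      ((volume : Measure Space).restrict (cubeIco c' b)) = volume.restrict Q := by
    rw [Measure.prod_restrict, ← Measure.volume_eq_prod]
  -- the Poincaré property of `C × C'`
  haveI := isFiniteMeasure_restrict_cubeIco c b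
  haveI := isFiniteMeasure_restrict_cubeIco c' b
  have hP := (isPoincare_cubeIco (E := ℝ) c hb).prod (isPoincare_cubeIco (E := ℝ) c' hb)
  rw [hμ] at hP
  -- cut `F` off outside a ball containing `Q`
  obtain ⟨R, hR, hsub⟩ := exists_prod_cubeIco_subset_ball c c' b
  obtain ⟨g, hg, hgeq⟩ := exists_bddC1_eq_of_contDiff (E := ℝ) hF hR
  have heq : ∀ p ∈ Q, g p = F p := fun p hp => (hgeq p (hsub hp)).1
  have heq' : ∀ p ∈ Q, fderiv ℝ g p = fderiv ℝ F p := fun p hp => (hgeq p (hsub hp)).2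
  obtain ⟨-, ⟨C, hC⟩, -⟩ := id hg
  haveI : IsFiniteMeasure ((volume : Measure (Space × Space)).restrict Q) := by
    rw [← hμ]; infer_instance
  have key := hP g hg
  have hvar := integral_norm_sub_sq_eq (μ := volume.restrict Q)
    hg.1.continuous.aestronglyMeasurable hC 0
  simp only [sub_zero] at hvar
  -- the total mass and the mean
  have hmass : ((volume : Measure (Space × Space)).restrict Q).real univ = b ^ 6 := by
    rw [measureReal_restrict_apply_univ, hQ, volume_real_prod_cubeIco c c' hb.le]
  set I : ℝ := ∫ p in Q, F p with hI
  have havg : ⨍ p, g p ∂(volume.restrict Q) = I / b ^ 6 := by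
    rw [average_eq, hmass, setIntegral_congr_fun hQm heq, smul_eq_mul, hI]
    ring
  rw [havg] at key hvar
  -- replace `g` by `F` on `Q`
  have e1 : ∫ p in Q, ‖g p‖ ^ 2 = ∫ p in Q, F p ^ 2 :=
    setIntegral_congr_fun hQm fun p hp => by rw [heq p hp, Real.norm_eq_abs, sq_abs]
  have e2 : ∫ p in Q, ‖g p - I / b ^ 6‖ ^ 2 = ∫ p in Q, (F p - I / b ^ 6) ^ 2 :=
    setIntegral_congr_fun hQm fun p hp => by rw [heq p hp, Real.norm_eq_abs, sq_abs]
  have e3 : ∫ p in Q, ∑ i, ‖fderiv ℝ g p (Sum.elim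
      (fun k : Fin 3 => (EuclideanSpace.single k (1 : ℝ), (0 : Space)))
      (fun k : Fin 3 => ((0 : Space), EuclideanSpace.single k (1 : ℝ))) i)‖ ^ 2 =
      ∫ p in Q, ((∑ k, fderiv ℝ F p (EuclideanSpace.single k 1, 0) ^ 2) +
        ∑ k, fderiv ℝ F p (0, EuclideanSpace.single k 1) ^ 2) := by
    refine setIntegral_congr_fun hQm fun p hp => ?_
    simp only [heq' p hp, Fintype.sum_sum_type, Sum.elim_inl, Sum.elim_inr, Real.norm_eq_abs,
      sq_abs]
  rw [e2, e3] at key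
  rw [e1, e2, hmass] at hvar
  rw [hvar]
  have hb6 : b ^ 6 * ‖I / b ^ 6‖ ^ 2 = I ^ 2 / b ^ 6 := by
    rw [Real.norm_eq_abs, sq_abs]
    field_simp
  rw [hb6]
  linarith

/-- The fundamental cell `[0,L)³` is the half-open cube of side `L` at the origin. [folklore] -/
theorem cell_eq_cubeIco (L : ℝ) : cell L = cubeIco (fun _ => 0) L := by
  ext ξ; simp [cell, cubeIco]

end Cubes

/-! ## The `M³` cubes of side `L/M` tile the fundamental cell -/

section Tiling

variable {M : ℕ} {L : ℝ}

/-- The lower corner `b·x` of the cube with integer label `x ∈ (Fin M)³`. [folklore] -/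
def corner (M : ℕ) (b : ℝ) (x : Fin 3 → Fin M) : Fin 3 → ℝ := fun k => ((x k : ℕ) : ℝ) * b

/-- Each cube `∏ₖ [xₖ b, (xₖ+1) b)`, `b = L/M`, lies in the fundamental cell `[0,L)³`.
[folklore] -/
theorem cubeIco_corner_subset_cell (hL : 0 < L) (hM : 1 ≤ M) (x : Fin 3 → Fin M) :
    cubeIco (corner M (L / M) x) (L / M) ⊆ cell L := by
  have hMpos : (0 : ℝ) < M := by exact_mod_cast hM
  have hb : 0 < L / M := div_pos hL hMpos
  intro ξ hξ k
  obtain ⟨h1, h2⟩ := hξ k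
  simp only [corner] at h1 h2
  have hx0 : (0 : ℝ) ≤ ((x k : ℕ) : ℝ) * (L / M) := by positivity
  have hx1 : ((x k : ℕ) : ℝ) * (L / M) + L / M ≤ L := by
    have hle : ((x k : ℕ) : ℝ) + 1 ≤ M := by exact_mod_cast Nat.succ_le_of_lt (x k).isLt
    calc ((x k : ℕ) : ℝ) * (L / M) + L / M = (((x k : ℕ) : ℝ) + 1) * (L / M) := by ring
      _ ≤ (M : ℝ) * (L / M) := mul_le_mul_of_nonneg_right hle hb.le
      _ = L := by field_simp
  exact ⟨le_trans hx0 h1, lt_of_lt_of_le h2 hx1⟩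

/-- Distinct cubes of the grid are disjoint. [folklore] -/
theorem pairwise_disjoint_cubeIco_corner {b : ℝ} (hb : 0 < b) :
    Pairwise (Function.onFun Disjoint fun x : Fin 3 → Fin M => cubeIco (corner M b x) b) := by
  intro x y hxy
  rw [Function.onFun, Set.disjoint_left]
  intro ξ hx hy
  apply hxy
  funext k
  obtain ⟨h1, h2⟩ := hx k
  obtain ⟨h3, h4⟩ := hy k
  simp only [corner] at h1 h2 h3 h4
  have a1 : ((x k : ℕ) : ℝ) < (y k : ℕ) + 1 := by
    by_contra hc
    push Not at hc
    have := mul_le_mul_of_nonneg_right hc hb.le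
    linarith
  have a2 : ((y k : ℕ) : ℝ) < (x k : ℕ) + 1 := by
    by_contra hc
    push Not at hc
    have := mul_le_mul_of_nonneg_right hc hb.le
    linarith
  have a1' : (x k : ℕ) < (y k : ℕ) + 1 := by exact_mod_cast a1
  have a2' : (y k : ℕ) < (x k : ℕ) + 1 := by exact_mod_cast a2
  exact Fin.ext (by omega)

/-- **The `M³` cubes of side `L/M` tile `[0,L)³`** (`M ≥ 1`; the label of `ξ` is `⌊ξ M/L⌋`
coordinatewise). [folklore] -/
theorem iUnion_cubeIco_corner (hL : 0 < L) (hM : 1 ≤ M) :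
    ⋃ x : Fin 3 → Fin M, cubeIco (corner M (L / M) x) (L / M) = cell L := by
  have hMpos : (0 : ℝ) < M := by exact_mod_cast hM
  have hb : 0 < L / M := div_pos hL hMpos
  ext ξ
  simp only [mem_iUnion]
  constructor
  · rintro ⟨x, hx⟩
    exact cubeIco_corner_subset_cell hL hM x hx
  · intro hξ
    have h0 : ∀ k, 0 ≤ ξ k / (L / M) := fun k => div_nonneg (hξ k).1 hb.le
    have hlt : ∀ k, ⌊ξ k / (L / M)⌋₊ < M := fun k => by
      rw [Nat.floor_lt (h0 k), div_lt_iff₀ hb]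
      calc ξ k < L := (hξ k).2
        _ = (M : ℝ) * (L / M) := by field_simp
    refine ⟨fun k => ⟨⌊ξ k / (L / M)⌋₊, hlt k⟩, fun k => ⟨?_, ?_⟩⟩
    · calc corner M (L / M) (fun k => ⟨⌊ξ k / (L / M)⌋₊, hlt k⟩) k
          = ((⌊ξ k / (L / M)⌋₊ : ℕ) : ℝ) * (L / M) := rfl
        _ ≤ ξ k / (L / M) * (L / M) :=
            mul_le_mul_of_nonneg_right (Nat.floor_le (h0 k)) hb.le
        _ = ξ k := div_mul_cancel₀ _ hb.ne'
    · calc ξ k = ξ k / (L / M) * (L / M) := (div_mul_cancel₀ _ hb.ne').symm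
        _ < (((⌊ξ k / (L / M)⌋₊ : ℕ) : ℝ) + 1) * (L / M) :=
            mul_lt_mul_of_pos_right (Nat.lt_floor_add_one _) hb
        _ = corner M (L / M) (fun k => ⟨⌊ξ k / (L / M)⌋₊, hlt k⟩) k + L / M := by
            simp only [corner]; ring

end Tiling

end CellNormRetention

/-! ## The registered sub-goal of this helper file -/

/-- **Registered sub-goal `cellNormRetention_cubePairPoincare`** (stub of crux item
stmt-AtomisticToContinuum-9674, registered for this helper file; its one-line signature is
`CellNormRetention.sq_integral_le_of_contDiff` written out with global names only): the
Neumann–Poincaré variance bound on a pair of cubes of side `b` for `C¹` functions. [folklore] -/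
theorem cellNormRetention_cubePairPoincare : ∀ (F : EuclideanSpace ℝ (Fin 3) × EuclideanSpace ℝ (Fin 3) → ℝ), ContDiff ℝ 1 F → ∀ (c c' : Fin 3 → ℝ) (b : ℝ), 0 < b → MeasureTheory.integral (MeasureTheory.Measure.restrict MeasureTheory.volume ({ξ : EuclideanSpace ℝ (Fin 3) | ∀ k : Fin 3, ξ k ∈ Set.Ico (c k) (c k + b)} ×ˢ {η : EuclideanSpace ℝ (Fin 3) | ∀ k : Fin 3, η k ∈ Set.Ico (c' k) (c' k + b)})) (fun p => F p ^ 2) ≤ MeasureTheory.integral (MeasureTheory.Measure.restrict MeasureTheory.volume ({ξ : EuclideanSpace ℝ (Fin 3) | ∀ k : Fin 3, ξ k ∈ Set.Ico (c k) (c k + b)} ×ˢ {η : EuclideanSpace ℝ (Fin 3) | ∀ k : Fin 3, η k ∈ Set.Ico (c' k) (c' k + b)})) (fun p => F p) ^ 2 / b ^ 6 + (b / Real.pi) ^ 2 * MeasureTheory.integral (MeasureTheory.Measure.restrict MeasureTheory.volume ({ξ : EuclideanSpace ℝ (Fin 3) | ∀ k : Fin 3, ξ k ∈ Set.Ico (c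 k) (c k + b)} ×ˢ {η : EuclideanSpace ℝ (Fin 3) | ∀ k : Fin 3, η k ∈ Set.Ico (c' k) (c' k + b)})) (fun p => (∑ k : Fin 3, fderiv ℝ F p (EuclideanSpace.single k (1 : ℝ), 0) ^ 2) + ∑ k : Fin 3, fderiv ℝ F p (0, EuclideanSpace.single k (1 : ℝ)) ^ 2) :=
  fun _ hF c c' _ hb => CellNormRetention.sq_integral_le_of_contDiff hF c c' hb


end Summit.AtomisticToContinuum.BoseEinsteinCondensation.Cruxes.LatticeToPeriodicBridge.CoarseCellLorentzian

end
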